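import Literature.AlgebraicGeometry.Modules.ModuleCechStrataBaseChange
import HarnessLib

/-!
# The module Čech complex of a vector bundle on `P ×_K T` over an affine noetherian base is perfect, given
# finiteness on the prime strata (Görtz–Wedhorn II, Thm. 23.133 / Cor. 23.135; Mumford AV §5, Lemma 1; EGA III 6.10.5)

Setting: `K` a field, `P → Spec K` (flat), `T` an AFFINE `K`-scheme with NOETHERIAN ring `A = Γ(T, 𝒪_T)`
(possibly non-reduced, reducible), `X = P ×_K T` with `ρ = pr_T♯`, a finite family `𝓥` of affine opens of
`X` with affine intersections, and a finite locally free `L` on `X`.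

* `Modules.StratumCechFinite P T 𝓥 L` — the per-stratum input (a `Prop` with parameters): on each closed
  stratum `g : P ×_K Spec(A⧸𝔭) ↪ X` (`Modules/AffineStrata`) the module Čech cohomology
  `Hⁱ(Č•(g⁻¹𝓥, g^*L))` is a finitely generated `A`-module (for `P` proper and geometrically integral and `L`
  of rank one it is discharged in `Modules/ModuleCechStratumFinite`);
* `Modules.strataFinite_sectionsSystem` — it implies `OrderedCech.StrataFinite` for the system of sections
  (base change to the stratum, `Modules/ModuleCechStrataBaseChange`);
* `Modules.flat_secMod_baseToTotal` — the members `Γ(L, V_s)` are `A`-flat (Mumford §5: "the Čech complex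
  … is a complex of `A`-flat modules");
* **`Modules.module_finite_homology_cechComplex`** — `Hⁱ(Č•(𝓥, L))` is a finitely generated `A`-module
  (noetherian dévissage over the strata, `Algebra/Homology/OrderedCechSystemDevissage`);
* **`Modules.exists_strictlyPerfect_quasiIso_cechComplex`** — there is a complex `K•` of finitely
  generated projective `A`-modules in degrees `[0, r]` (`#ι ≤ r + 1`) with a quasi-isomorphism
  `K• → Č•(𝓥, L)`: the Grothendieck complex of `L` over `Spec A` (Görtz–Wedhorn II, Cor. 23.135; Mumford §5,
  Lemma 1, "second half"; EGA III 6.10.5).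

Everything is proved from the strata input; no named facts. Mathlib searched (pin):
`HasRingHomProperty.appLE`, `MorphismProperty.pullback_snd` (used); Mathlib has no Grothendieck complex /
perfectness of Čech complexes. Cell `hodgecm-mathlib`, M13 node N1 (1a-γ) (B-p10 (g8), cut/couriered by
B-p15 (g8) per B-plan1 R140/R142); generic, books 0.

## References

* U. Görtz, T. Wedhorn, *Algebraic Geometry II: Cohomology of Schemes* (2023),
  doi:10.1007/978-3-658-43031-3: Thm. 23.133 with proof, Steps (I)–(III), Rem. 23.134, Cor. 23.135
  (pp. 354–355); Thm. 23.17; Thm. 24.66 (p. 405). [GortzWedhorn2023]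
* D. Mumford, *Abelian Varieties*, TIFR Studies in Mathematics 5 (1970), §5, Lemmas 1–2; §10. [MumfordAV1970]
* A. Grothendieck, EGA III₂ (Publ. Math. IHÉS 17, 1963), (6.10.5), (7.7.6). [EGA3]
-/

universe u

open CategoryTheory CategoryTheory.Limits AlgebraicGeometry TopologicalSpace Opposite MonoidalCategory
open CartesianMonoidalCategory TensorProduct
open Literature.AlgebraicGeometry.Motives Literature.Algebra.Homology

set_option backward.isDefEq.respectTransparency false

noncomputable section

namespace Literature.AlgebraicGeometry.Modules

variable {K : Type u} [Field K] (P T : SchemeOver K) [IsAffine T.left]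
variable {ι : Type} [LinearOrder ι] [Fintype ι] (𝓥 : ι → (P ⊗ T).left.Opens) (L : (P ⊗ T).left.Modules)

/-- **The per-stratum finiteness input**: for every prime `𝔭` of `A = Γ(T, 𝒪_T)`, the module Čech
cohomology of `g^*L` for the pulled-back cover `g⁻¹𝓥` on the stratum `g : P ×_K Spec(A⧸𝔭) ↪ P ×_K T` is
finitely generated over `A` (Görtz–Wedhorn II, Thm. 23.17 for the INTEGRAL proper `P ×_K Spec(A⧸𝔭)`).
[cite: GortzWedhorn2023, Thm. 23.17] -/
def StratumCechFinite : Prop :=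
  ∀ (𝔭 : PrimeSpectrum Γ(T.left, ⊤)) (i : ℤ), Module.Finite Γ(T.left, ⊤)
    ((cechComplex (strataCover P T 𝔭 𝓥) (strataMod P T 𝔭 L) (baseToStrataTotal P T 𝔭)).homology i)

variable (hV : ∀ s : Finset ι, s.Nonempty → IsAffineOpen (cechOpen 𝓥 s)) (hL : IsFiniteLocallyFree L)

include hV hL in
omit [Fintype ι] in
/-- **The strata of the system of sections are finite** (`OrderedCech.StrataFinite`) as soon as the module
Čech cohomology on every integral stratum is (base change `A⧸𝔭 ⊗_A Γ(L, V_s) ≅ Γ(g^*L, g⁻¹V_s)`).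
[cite: GortzWedhorn2023, Thm. 23.133, proof, Step (I) (p. 354)] -/
theorem strataFinite_sectionsSystem (hstr : StratumCechFinite P T 𝓥 L) :
    OrderedCech.StrataFinite (sectionsSystem 𝓥 L (baseToTotal P T)) :=
  fun 𝔭 i => module_finite_homology_lTensorSys_quotient P T 𝔭 𝓥 L hV hL (hstr 𝔭) i

omit [IsAffine T.left] in
/-- The structure map `A → Γ(V_s, 𝒪)` is the `appLE` of `pr_T`. [folklore] [cite: GortzWedhorn2023, Thm. 23.133, proof, Step (I) (p. 354)] -/
theorem toSections_baseToTotal (U : (P ⊗ T).left.Opens) :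
    toSections (baseToTotal P T) U = ((snd P T).left.appLE ⊤ U le_top).hom := rfl

include hV hL in
omit [LinearOrder ι] [Fintype ι] in
/-- **The members `Γ(L, V_s)` are flat over `A`** (`pr_T : P ×_K T → T` flat, `V_s` and `T` affine,
`L` finite locally free; Mumford §5: "the Čech complex … is a complex of `A`-flat modules").
[cite: MumfordAV1970, §5, Lemma 1] -/
theorem flat_secMod_baseToTotal [Flat P.hom] (s : Finset ι) (hs : s.Nonempty) :
    Module.Flat Γ(T.left, ⊤) (SecMod L (baseToTotal P T) (cechOpen 𝓥 s)) := by
  haveI : Flat (snd P T).left := MorphismProperty.pullback_snd (P := @Flat) _ _ inferInstance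
  refine flat_secMod_of_isFiniteLocallyFree L (baseToTotal P T) (hV s hs) hL ?_
  exact HasRingHomProperty.appLE (P := @Flat) (snd P T).left inferInstance ⟨⊤, isAffineOpen_top T.left⟩
    ⟨cechOpen 𝓥 s, hV s hs⟩ le_top

include hV hL in
/-- **`Hⁱ(Č•(𝓥, L))` is a finitely generated `A`-module** (dévissage over the prime strata of the noetherian
base, `OrderedCech.module_finite_homology_of_strata`). [cite: GortzWedhorn2023, Thm. 23.133, proof, Step (I) (p. 354)] -/
theorem module_finite_homology_cechComplex [IsNoetherianRing Γ(T.left, ⊤)] [Flat P.hom]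
    (hstr : StratumCechFinite P T 𝓥 L) (i : ℤ) :
    Module.Finite Γ(T.left, ⊤) ((cechComplex 𝓥 L (baseToTotal P T)).homology i) :=
  OrderedCech.module_finite_homology_of_strata _ (flat_secMod_baseToTotal P T 𝓥 L hV hL)
    (strataFinite_sectionsSystem P T 𝓥 L hV hL hstr) i

include hV hL in
/-- **The module Čech complex of `L` on `P ×_K T` is (strictly) perfect over the affine noetherian base**:
a complex `K•` of finitely generated projective `A`-modules in degrees `[0, r]` with a quasi-isomorphism
`K• → Č•(𝓥, L)` — the Grothendieck complex (Görtz–Wedhorn II, Cor. 23.135; Mumford §5, Lemma 1; EGA III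
6.10.5). [cite: GortzWedhorn2023, Cor. 23.135 (p. 355)] -/
theorem exists_strictlyPerfect_quasiIso_cechComplex [IsNoetherianRing Γ(T.left, ⊤)] [Flat P.hom]
    (hstr : StratumCechFinite P T 𝓥 L) (r : ℕ) (hr : (Fintype.card ι : ℤ) ≤ r + 1) :
    ∃ (K : CochainComplex (ModuleCat.{u} Γ(T.left, ⊤)) ℤ) (ψ : K ⟶ cechComplex 𝓥 L (baseToTotal P T)),
      QuasiIso ψ ∧ K.IsStrictlyGE 0 ∧ K.IsStrictlyLE (r : ℤ) ∧
      ∀ n, Module.Finite Γ(T.left, ⊤) (K.X n) ∧ Module.Projective Γ(T.left, ⊤) (K.X n) :=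
  OrderedCech.exists_strictlyPerfect_quasiIso_of_strata _ (flat_secMod_baseToTotal P T 𝓥 L hV hL)
    (strataFinite_sectionsSystem P T 𝓥 L hV hL hstr) r hr

end Literature.AlgebraicGeometry.Modules

end


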